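import Literature.Analysis.FluidPDE.SteadyLiouvilleCriteria
import Literature.Analysis.FluidPDE.ElgindiBlowup
import Literature.Analysis.FluidPDE.VorticityCalculus
import Literature.Analysis.FunctionSpaces.WeakLp
import HarnessLib

/-!
# Wu 2026 (arXiv preprint): the steady Liouville theorem at the weak-Lorentz vorticity endpoint
# `curl v ∈ L^{9/5,∞}(ℝ³)` and at the critical pointwise rate `|curl v| = O(|x|^{-5/3})` — named facts

Topic `Literature/Analysis/FluidPDE`; two NAMED FACTS (`def … : Prop`, D-0014), statement-only,
plus one proved corollary. Typed at the request of DIRECTOR-NS (#40, 2026-08-27) for the route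
`GaldiLiouvilleGate` of `NavierStokesRegularity`, crux item `stmt-NavierStokesRegularity-0897`
(`Summit.NavierStokesRegularity.NavierStokesRegularity.Theses.GaldiLiouvilleGate.CriticalRateLiouville`),
whose companion file `SteadyLiouvilleCriteria.lean` records (August 2026) that a Liouville theorem AT
Galdi's critical rate `|U| ~ |x|^{-2/3}`, `|∇U| ~ |x|^{-5/3}` with ARBITRARY constants is "NOT in
print" (only small-constant / little-`o` / logarithmic versions: Kozono–Terasawa–Wakasugi 2017,
Seregin–Wang 2020, Tsai 2021, Wang–Yang 2026).

**STATUS FLAG — read before use.** The source is a PREPRINT, arXiv:2608.22471v1, posted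
23 August 2026 (four days before this file), 27 pages, single author, UNREFEREED; its p. 27
carries the declaration "During the preparation of this manuscript, the author used ChatGPT
(OpenAI) to assist with language editing, organization of the exposition, and preliminary checks of
intermediate calculations and mathematical arguments. The author critically reviewed and
independently verified all AI-assisted output". Under the tree's model an unrefereed claimed proof
is vendored as a NAMED FACT ONLY (never a `sorry`, never a theorem): the two `def`s below may be
taken as HYPOTHESES `(h : Wu2026_thm11)` / `(h : Wu2026_cor12)` by route files, which must then say
"conditional on the preprint arXiv:2608.22471v1"; nothing here endorses the proof. A referee-style
read of the proof spine is filed as evidence on item 0897 by the cell's critic seat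
(`ns-typeII-critic-1`, `WU2026-SPINE-0897.md`). If the preprint is refereed or its proof is ported,
`theorem Wu2026_thm11_holds : Wu2026_thm11` goes in a sibling `…Proofs.lean` / `…Holds.lean`.

## Source (verbatim, p. 1–2 of arXiv:2608.22471v1; held text `paper:arxiv-2608.22471`)

"We consider smooth solutions of `−Δv + (v·∇)v + ∇p = 0`, `div v = 0` in `ℝ³` (1.1) such that
`v(x) → 0` as `|x| → ∞`. It remains open whether these conditions together with `∫_{ℝ³}|∇v|²dx < ∞`
force `v` to vanish; see [8, 11]. We prove a Liouville theorem at the global weak-Lorentz endpoint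
for the vorticity `ω := curl v`." (p. 1.) "The exponent `9/5` is tied to the critical pointwise
scale `|ω(x)| ≃ |x|^{-5/3}` studied by Kozono–Terasawa–Wakasugi [10]. … the model tail
`|x|^{-5/3}1_{|x|>1}` belongs to the weak space but not to the strong one.

**Theorem 1.1** (Global weak-Lorentz vorticity endpoint). Let `(v, p)` be a smooth solution of
(1.1) in `ℝ³` such that `v(x) → 0` as `|x| → ∞`, and let `ω = curl v`. If `ω ∈ L^{9/5,∞}(ℝ³)`
(1.4), then `v ≡ 0`.

No smallness condition is imposed on the weak Lorentz norm. Finite Dirichlet energy is also not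
assumed; Theorem 2.1 derives it from (1.4) by combining the endpoint Biot–Savart estimate with
[15, Theorem 1.1(i)] (= Seregin–Wang 2020, in the tree as `SereginWang2020_annular_liouville`).

**Corollary 1.2** (Critical pointwise criterion without smallness). Let `(v, p)` be a smooth
solution of (1.1) in `ℝ³` such that `v(x) → 0` as `|x| → ∞`. If
`E_ω := limsup_{|x|→∞} |x|^{5/3}|curl v(x)| < ∞`, then `v ≡ 0`.
Indeed, `E_ω < ∞` gives `|ω(x)| ≤ C|x|^{-5/3}` outside a sufficiently large ball. Together with
smoothness on the remaining bounded set, this places `ω` in `L^{9/5,∞}(ℝ³)`. No smallness is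
required." (p. 2.)

## Rendering choices (those of `SteadyLiouvilleCriteria.lean`, verbatim where possible)

* "smooth solution of (1.1)" = the tree's profile structure at rate `a = 0`,
  `IsLerayProfile ν 0 U P` (`−νΔU + (U·∇)U + ∇P = 0`, `div U = 0`, `U ∈ C²`, `P ∈ C¹`), plus
  `ContDiff ℝ ∞` for both `U` and `P` ("smooth").
* "`v(x) → 0` as `|x| → ∞`" = `Tendsto U (cocompact ℝ³) (𝓝 0)`.
* `ω = curl v` = `Literature.Analysis.FluidPDE.curl U` (`VectorCalculus.lean`).
* "`ω ∈ L^{9/5,∞}(ℝ³)`" = `Literature.Analysis.FunctionSpaces.MemWeakLp (curl U) (9/5) volume`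
  (`WeakLp.lean`: a.e.-strongly measurable with `sup_{t>0} t^{9/5}|{|ω| > t}| < ∞` — Grafakos,
  Def. 1.1.5; the paper's `L^{9/5,∞}` is this Marcinkiewicz space, p. 2: "`L^{9/5,∞}` is its weak
  endpoint").
* "`limsup_{|x|→∞} |x|^{5/3}|curl v(x)| < ∞`" is rendered as its definitional content for a
  real-valued function, an EVENTUAL BOUND: `∃ C R, ∀ y, R ≤ ‖y‖ → ‖y‖^{5/3}‖curl U y‖ ≤ C`
  (equivalent to `IsBoundedUnder (· ≤ ·) (cocompact ℝ³) (fun y ↦ ‖y‖^{5/3}‖curl U y‖)`; the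
  explicit form is what route files quote).
* Viscosity. The source prints `ν = 1`. As for every fact in `SteadyLiouvilleCriteria.lean` we
  state the `ν`-family, `ν > 0`: `(U, P)` solves the `ν`-system iff `(ν⁻¹U, ν⁻²P)` solves (1.1),
  and each hypothesis (decay to `0`, `curl U ∈ L^{9/5,∞}`, the `limsup` bound) is invariant under
  `U ↦ ν⁻¹U`; so the family is equivalent to its printed `ν = 1` instance by this substitution and
  nothing else is generalised.
* Conclusion "`v ≡ 0`" = `U = 0` (as the route decls `GaldiLiouville`, `CriticalRateLiouville`).

## What is proved here

`Wu2026_cor12.of_fderiv_decay`: under `Wu2026_cor12`, a smooth steady solution with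
`‖U(y)‖ ≤ C(1+‖y‖)^{-2/3}` and `‖∇U(y)‖ ≤ C(1+‖y‖)^{-5/3}` (ANY `C`) vanishes — the hypotheses of
the route decl `CriticalRateLiouville` minus its (then unused) pressure decay, in this directory's
vocabulary (`‖curl U y‖ ≤ 4‖fderiv ℝ U y‖`, `norm_curl_le_four_mul`). The route-side dictionary
`Wu2026_cor12 → CriticalRateLiouville` is therefore one line; it is NOT stated here (Literature does
not import `Summits`).

## References

* W. Wu, *The Global Weak-Lorentz Vorticity Endpoint in the Stationary Navier–Stokes Liouville
  Problem*, arXiv:2608.22471v1 [math.AP], 23 Aug 2026, Theorem 1.1 and Corollary 1.2 (p. 2);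
  AI-assistance declaration p. 27. PREPRINT, UNREFEREED. [Wu2026]
* H. Kozono, Y. Terasawa, Y. Wakasugi, J. Funct. Anal. 272 (2017) 804–818 (the `|x|^{-5/3}`
  vorticity scale with smallness; ref. [10] of the source).
* G. Seregin, W. Wang, *Sufficient conditions on Liouville type theorems for the 3D steady
  Navier–Stokes equations*, St. Petersburg Math. J. 31 (2020) 387–393 (ref. [15];
  `SereginWang2020_annular_liouville` in `SteadyLiouvilleCriteria.lean`).
-/

noncomputable section

open MeasureTheory Set Function Filter Topology
open scoped ENNReal NNReal

namespace Literature.Analysis.FluidPDE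

/-- **Wu 2026, Theorem 1.1** (arXiv:2608.22471v1, p. 2 — PREPRINT of 23 Aug 2026, UNREFEREED,
author-declared LLM assistance p. 27; vendored as a HYPOTHESIS only): "Let `(v, p)` be a smooth
solution of `−Δv + (v·∇)v + ∇p = 0`, `div v = 0` in `ℝ³` such that `v(x) → 0` as `|x| → ∞`, and
let `ω = curl v`. If `ω ∈ L^{9/5,∞}(ℝ³)`, then `v ≡ 0`." ("No smallness condition is imposed on
the weak Lorentz norm. Finite Dirichlet energy is also not assumed.") Stated for every viscosity
`ν > 0` (equivalent to the printed `ν = 1` by `U ↦ ν⁻¹U`, `P ↦ ν⁻²P`), with "smooth steady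
solution" = `IsLerayProfile ν 0 U P` + `C^∞`, decay = `Tendsto U (cocompact ℝ³) (𝓝 0)`, and
`ω ∈ L^{9/5,∞}` = `MemWeakLp (curl U) (9/5) volume`. [cite: Wu2026, Thm. 1.1 (p. 2; arXiv:2608.22471v1, preprint, unrefereed)] -/
def Wu2026_thm11 : Prop :=
  ∀ ν : ℝ, 0 < ν → ∀ (U : EuclideanSpace ℝ (Fin 3) → EuclideanSpace ℝ (Fin 3))
    (P : EuclideanSpace ℝ (Fin 3) → ℝ), IsLerayProfile ν 0 U P →
    ContDiff ℝ (⊤ : ℕ∞) U → ContDiff ℝ (⊤ : ℕ∞) P →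
    Tendsto U (cocompact (EuclideanSpace ℝ (Fin 3))) (𝓝 0) →
    FunctionSpaces.MemWeakLp (curl U) ((9 : ℝ≥0∞) / 5) volume →
    U = 0

/-- **Wu 2026, Corollary 1.2** (arXiv:2608.22471v1, p. 2 — PREPRINT, UNREFEREED, author-declared
LLM assistance p. 27; vendored as a HYPOTHESIS only), "Critical pointwise criterion without
smallness": "Let `(v, p)` be a smooth solution of (1.1) in `ℝ³` such that `v(x) → 0` as
`|x| → ∞`. If `E_ω := limsup_{|x|→∞} |x|^{5/3}|curl v(x)| < ∞`, then `v ≡ 0`." Rendered for every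
`ν > 0` (equivalent to the printed `ν = 1` by scaling), with the finite `limsup` written as its
content, an eventual bound `‖y‖^{5/3}‖curl U y‖ ≤ C` for `‖y‖ ≥ R`. This is the Liouville theorem
AT the Kozono–Terasawa–Wakasugi rate `|ω| ~ |x|^{-5/3}` with arbitrary constants that
`SteadyLiouvilleCriteria.lean` recorded as not in print before this preprint; it implies the route
decl `CriticalRateLiouville` (see `Wu2026_cor12.of_fderiv_decay`). [cite: Wu2026, Cor. 1.2 (p. 2; arXiv:2608.22471v1, preprint, unrefereed)] -/
def Wu2026_cor12 : Prop :=
  ∀ ν : ℝ, 0 < ν → ∀ (U : EuclideanSpace ℝ (Fin 3) → EuclideanSpace ℝ (Fin 3))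
    (P : EuclideanSpace ℝ (Fin 3) → ℝ), IsLerayProfile ν 0 U P →
    ContDiff ℝ (⊤ : ℕ∞) U → ContDiff ℝ (⊤ : ℕ∞) P →
    Tendsto U (cocompact (EuclideanSpace ℝ (Fin 3))) (𝓝 0) →
    (∃ C R : ℝ, ∀ y : EuclideanSpace ℝ (Fin 3),
      R ≤ ‖y‖ → ‖y‖ ^ (5 / 3 : ℝ) * ‖curl U y‖ ≤ C) →
    U = 0

/-- A velocity field with `‖U(y)‖ ≤ C(1 + ‖y‖)^{-2/3}` tends to `0` at infinity (along the
cocompact filter of `ℝ³`). [folklore] -/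
private theorem tendsto_cocompact_zero_of_norm_le_rpow
    {U : EuclideanSpace ℝ (Fin 3) → EuclideanSpace ℝ (Fin 3)} {C : ℝ}
    (hU : ∀ y, ‖U y‖ ≤ C * (1 + ‖y‖) ^ (-(2 / 3 : ℝ))) :
    Tendsto U (cocompact (EuclideanSpace ℝ (Fin 3))) (𝓝 0) := by
  rw [tendsto_zero_iff_norm_tendsto_zero]
  -- the majorant `C(1+‖y‖)^{-2/3}` tends to `0` along `cocompact`
  have hmaj : Tendsto (fun y : EuclideanSpace ℝ (Fin 3) => C * (1 + ‖y‖) ^ (-(2 / 3 : ℝ)))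
      (cocompact (EuclideanSpace ℝ (Fin 3))) (𝓝 0) := by
    have h1 : Tendsto (fun y : EuclideanSpace ℝ (Fin 3) => 1 + ‖y‖)
        (cocompact (EuclideanSpace ℝ (Fin 3))) atTop :=
      tendsto_atTop_add_const_left _ _ tendsto_norm_cocompact_atTop
    have h2 : Tendsto (fun y : EuclideanSpace ℝ (Fin 3) => (1 + ‖y‖) ^ (-(2 / 3 : ℝ)))
        (cocompact (EuclideanSpace ℝ (Fin 3))) (𝓝 0) :=
      (tendsto_rpow_neg_atTop (by norm_num : (0 : ℝ) < 2 / 3)).comp h1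
    simpa using h2.const_mul C
  refine squeeze_zero (fun y => norm_nonneg _) hU hmaj

/-- **Corollary 1.2 implies the critical-rate Liouville statement with gradient hypotheses**
(the hypotheses of the route decl `GaldiLiouvilleGate.CriticalRateLiouville`, item
`stmt-NavierStokesRegularity-0897`, minus its pressure decay): under `Wu2026_cor12`, a smooth steady
solution of the `ν`-Navier–Stokes system on `ℝ³` with `‖U(y)‖ ≤ C(1+‖y‖)^{-2/3}` and
`‖∇U(y)‖ ≤ C(1+‖y‖)^{-5/3}` for some constant `C` (no smallness) is identically zero. Proof:
`U → 0` from the velocity bound; `‖y‖^{5/3}‖curl U y‖ ≤ 4‖y‖^{5/3}‖∇U(y)‖ ≤ 4C` for all `y`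
(`norm_curl_le_four_mul` and `‖y‖ ≤ 1 + ‖y‖`). [cite: Wu2026, Cor. 1.2 (p. 2; arXiv:2608.22471v1, preprint, unrefereed)] -/
theorem Wu2026_cor12.of_fderiv_decay (h : Wu2026_cor12) {ν : ℝ} (hν : 0 < ν)
    {U : EuclideanSpace ℝ (Fin 3) → EuclideanSpace ℝ (Fin 3)}
    {P : EuclideanSpace ℝ (Fin 3) → ℝ} (hUP : IsLerayProfile ν 0 U P)
    (hU : ContDiff ℝ (⊤ : ℕ∞) U) (hP : ContDiff ℝ (⊤ : ℕ∞) P)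
    (hdec : ∃ C : ℝ, ∀ y, ‖U y‖ ≤ C * (1 + ‖y‖) ^ (-(2 / 3 : ℝ)) ∧
      ‖fderiv ℝ U y‖ ≤ C * (1 + ‖y‖) ^ (-(5 / 3 : ℝ))) :
    U = 0 := by
  obtain ⟨C, hC⟩ := hdec
  have hC0 : 0 ≤ C := by
    have h0 := (hC 0).1
    simp only [norm_zero, add_zero, Real.one_rpow, mul_one] at h0
    exact (norm_nonneg _).trans h0
  refine h ν hν U P hUP hU hP (tendsto_cocompact_zero_of_norm_le_rpow fun y => (hC y).1)
    ⟨4 * C, 0, fun y _ => ?_⟩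
  have hy0 : 0 ≤ ‖y‖ := norm_nonneg y
  have h1 : 0 < 1 + ‖y‖ := by positivity
  -- `‖y‖^{5/3} (1+‖y‖)^{-5/3} ≤ 1`
  have hratio : ‖y‖ ^ (5 / 3 : ℝ) * (1 + ‖y‖) ^ (-(5 / 3 : ℝ)) ≤ 1 := by
    rw [Real.rpow_neg h1.le, ← div_eq_mul_inv, div_le_one (Real.rpow_pos_of_pos h1 _)]
    exact Real.rpow_le_rpow hy0 (by linarith) (by norm_num)
  calc ‖y‖ ^ (5 / 3 : ℝ) * ‖curl U y‖
      ≤ ‖y‖ ^ (5 / 3 : ℝ) * (4 * ‖fderiv ℝ U y‖) :=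
        mul_le_mul_of_nonneg_left (norm_curl_le_four_mul U y) (Real.rpow_nonneg hy0 _)
    _ ≤ ‖y‖ ^ (5 / 3 : ℝ) * (4 * (C * (1 + ‖y‖) ^ (-(5 / 3 : ℝ)))) :=
        mul_le_mul_of_nonneg_left (mul_le_mul_of_nonneg_left (hC y).2 (by norm_num))
          (Real.rpow_nonneg hy0 _)
    _ = 4 * C * (‖y‖ ^ (5 / 3 : ℝ) * (1 + ‖y‖) ^ (-(5 / 3 : ℝ))) := by ring
    _ ≤ 4 * C * 1 := mul_le_mul_of_nonneg_left hratio (by positivity)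
    _ = 4 * C := mul_one _


/-! ### Theorem 1.1 implies Corollary 1.2 (the source's one-line deduction, proved)

"Indeed, `E_ω < ∞` gives `|ω(x)| ≤ C|x|^{-5/3}` outside a sufficiently large ball. Together with
smoothness on the remaining bounded set, this places `ω` in `L^{9/5,∞}(ℝ³)`" (p. 2). Below:
continuity of `curl U` bounds it on the closed ball of radius `max R 1`, whence a GLOBAL bound
`‖curl U y‖ ≤ K‖y‖^{-5/3}` (`y ≠ 0`); the superlevel set `{‖curl U‖ > t}` then lies in the ball of
radius `(K/t)^{3/5}`, whose volume is `(K/t)^{9/5}|B₁|`, so `t^{9/5}|{‖curl U‖ > t}| ≤ K^{9/5}|B₁|`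
(Grafakos, Example 1.1.7: `|x|^{-n/p} ∈ L^{p,∞}`, here `n = 3`, `p = 9/5`). -/

/-- A smooth field whose curl obeys `‖y‖^{5/3}‖curl U y‖ ≤ C` for `‖y‖ ≥ R` obeys a global bound
`‖curl U y‖ ≤ K‖y‖^{-5/3}` for all `y ≠ 0`, with some `K > 0` (continuity on the ball
`‖y‖ ≤ max R 1`). [folklore] -/
private theorem exists_norm_curl_le_rpow {U : EuclideanSpace ℝ (Fin 3) → EuclideanSpace ℝ (Fin 3)}
    (hU : ContDiff ℝ (⊤ : ℕ∞) U) {C R : ℝ}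
    (h : ∀ y : EuclideanSpace ℝ (Fin 3), R ≤ ‖y‖ → ‖y‖ ^ (5 / 3 : ℝ) * ‖curl U y‖ ≤ C) :
    ∃ K : ℝ, 0 < K ∧ ∀ y : EuclideanSpace ℝ (Fin 3), y ≠ 0 →
      ‖curl U y‖ ≤ K * ‖y‖ ^ (-(5 / 3 : ℝ)) := by
  set R₀ : ℝ := max R 1 with hR₀def
  have hcont : Continuous (curl U) := continuous_curl (hU.of_le (mod_cast le_top))
  obtain ⟨B, hB⟩ := (isCompact_closedBall (0 : EuclideanSpace ℝ (Fin 3)) R₀).exists_bound_of_continuousOn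
    hcont.continuousOn
  refine ⟨max (max B 0 * R₀ ^ (5 / 3 : ℝ)) (max C 0) + 1, by positivity, fun y hy => ?_⟩
  have hy0 : 0 < ‖y‖ := norm_pos_iff.2 hy
  have hpow : 0 < ‖y‖ ^ (5 / 3 : ℝ) := Real.rpow_pos_of_pos hy0 _
  rw [Real.rpow_neg hy0.le, ← div_eq_mul_inv, le_div_iff₀ hpow]
  rcases le_or_gt ‖y‖ R₀ with hle | hlt
  · have h1 : ‖curl U y‖ ≤ max B 0 :=
      (hB y (mem_closedBall_zero_iff.2 hle)).trans (le_max_left _ _)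
    have h2 : ‖y‖ ^ (5 / 3 : ℝ) ≤ R₀ ^ (5 / 3 : ℝ) := Real.rpow_le_rpow hy0.le hle (by norm_num)
    calc ‖curl U y‖ * ‖y‖ ^ (5 / 3 : ℝ) ≤ max B 0 * R₀ ^ (5 / 3 : ℝ) :=
          mul_le_mul h1 h2 hpow.le (le_max_right _ _)
      _ ≤ max (max B 0 * R₀ ^ (5 / 3 : ℝ)) (max C 0) := le_max_left _ _
      _ ≤ max (max B 0 * R₀ ^ (5 / 3 : ℝ)) (max C 0) + 1 := le_add_of_nonneg_right zero_le_one
  · have h1 : ‖y‖ ^ (5 / 3 : ℝ) * ‖curl U y‖ ≤ C := h y ((le_max_left _ _).trans hlt.le)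
    calc ‖curl U y‖ * ‖y‖ ^ (5 / 3 : ℝ) = ‖y‖ ^ (5 / 3 : ℝ) * ‖curl U y‖ := mul_comm _ _
      _ ≤ max C 0 := h1.trans (le_max_left _ _)
      _ ≤ max (max B 0 * R₀ ^ (5 / 3 : ℝ)) (max C 0) := le_max_right _ _
      _ ≤ max (max B 0 * R₀ ^ (5 / 3 : ℝ)) (max C 0) + 1 := le_add_of_nonneg_right zero_le_one

/-- Under a global bound `‖curl U y‖ ≤ K‖y‖^{-5/3}` (`y ≠ 0`, `K > 0`), the superlevel set
`{t < ‖curl U‖}`, `t > 0`, lies in the ball of radius `(K/t)^{3/5}` about the origin. [folklore] -/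
private theorem setOf_lt_enorm_curl_subset_ball
    {U : EuclideanSpace ℝ (Fin 3) → EuclideanSpace ℝ (Fin 3)} {K : ℝ} (hK : 0 < K)
    (hb : ∀ y : EuclideanSpace ℝ (Fin 3), y ≠ 0 → ‖curl U y‖ ≤ K * ‖y‖ ^ (-(5 / 3 : ℝ)))
    {t : ℝ≥0} (ht : 0 < t) :
    {x : EuclideanSpace ℝ (Fin 3) | (t : ℝ≥0∞) < ‖curl U x‖ₑ} ⊆
      Metric.ball (0 : EuclideanSpace ℝ (Fin 3)) ((K / t) ^ (3 / 5 : ℝ)) := by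
  intro x hx
  rw [mem_setOf_eq, ← ofReal_norm, ← ENNReal.ofReal_coe_nnreal,
    ENNReal.ofReal_lt_ofReal_iff_of_nonneg (NNReal.coe_nonneg t)] at hx
  have htR : (0 : ℝ) < t := NNReal.coe_pos.2 ht
  have hKt : 0 < K / t := div_pos hK htR
  rw [Metric.mem_ball, dist_zero_right]
  rcases eq_or_ne x 0 with rfl | hx0
  · rw [norm_zero]; exact Real.rpow_pos_of_pos hKt _
  have hxpos : 0 < ‖x‖ := norm_pos_iff.2 hx0
  have h1 : (t : ℝ) < K * ‖x‖ ^ (-(5 / 3 : ℝ)) := hx.trans_le (hb x hx0)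
  rw [Real.rpow_neg hxpos.le, ← div_eq_mul_inv, lt_div_iff₀ (Real.rpow_pos_of_pos hxpos _)] at h1
  -- `‖x‖^{5/3} < K / t`
  have h2 : ‖x‖ ^ (5 / 3 : ℝ) < K / t := by
    rw [lt_div_iff₀ htR, mul_comm]; exact h1
  have h3 : (‖x‖ ^ (5 / 3 : ℝ)) ^ (3 / 5 : ℝ) < (K / t) ^ (3 / 5 : ℝ) :=
    Real.rpow_lt_rpow (Real.rpow_nonneg hxpos.le _) h2 (by norm_num)
  rwa [← Real.rpow_mul hxpos.le, show (5 / 3 : ℝ) * (3 / 5) = 1 by norm_num, Real.rpow_one] at h3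

/-- **Theorem 1.1 ⇒ Corollary 1.2** (Wu 2026, p. 2, the printed deduction: "`E_ω < ∞` gives
`|ω(x)| ≤ C|x|^{-5/3}` outside a sufficiently large ball. Together with smoothness on the remaining
bounded set, this places `ω` in `L^{9/5,∞}(ℝ³)`"). Hence of the two named facts of this file only
`Wu2026_thm11` is independent. [cite: Wu2026, Cor. 1.2 (p. 2, deduction from Thm. 1.1; arXiv:2608.22471v1, preprint, unrefereed)] -/
theorem Wu2026_cor12_of_thm11 (h : Wu2026_thm11) : Wu2026_cor12 := by
  intro ν hν U P hUP hU hP hT hE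
  obtain ⟨C, R, hCR⟩ := hE
  refine h ν hν U P hUP hU hP hT ?_
  obtain ⟨K, hK, hb⟩ := exists_norm_curl_le_rpow hU hCR
  have hcont : Continuous (curl U) := continuous_curl (hU.of_le (mod_cast le_top))
  refine ⟨hcont.aestronglyMeasurable, ?_⟩
  have hp : ((9 : ℝ≥0∞) / 5).toReal = (9 / 5 : ℝ) := by
    rw [ENNReal.toReal_div]; norm_num
  have hfin : ENNReal.ofReal (K ^ (9 / 5 : ℝ)) * volume (Metric.ball (0 : EuclideanSpace ℝ (Fin 3)) 1) < ∞ :=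
    ENNReal.mul_lt_top ENNReal.ofReal_lt_top measure_ball_lt_top
  refine lt_of_le_of_lt (FunctionSpaces.eWeakLpPow_le_iff.2 fun t => ?_) hfin
  rw [hp]
  rcases eq_or_ne t 0 with rfl | ht0
  · rw [ENNReal.coe_zero, ENNReal.zero_rpow_of_pos (by norm_num), zero_mul]
    exact bot_le
  · have ht : 0 < t := pos_iff_ne_zero.2 ht0
    have htR : (0 : ℝ) < t := NNReal.coe_pos.2 ht
    have hKt : 0 < K / t := div_pos hK htR
    set r : ℝ := (K / t) ^ (3 / 5 : ℝ) with hrdef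
    have hr : 0 < r := Real.rpow_pos_of_pos hKt _
    have hr3 : r ^ 3 = (K / t) ^ (9 / 5 : ℝ) := by
      rw [hrdef, ← Real.rpow_natCast, ← Real.rpow_mul hKt.le]; norm_num
    calc (t : ℝ≥0∞) ^ (9 / 5 : ℝ) * volume {x | (t : ℝ≥0∞) < ‖curl U x‖ₑ}
        ≤ (t : ℝ≥0∞) ^ (9 / 5 : ℝ) * volume (Metric.ball (0 : EuclideanSpace ℝ (Fin 3)) r) := by
          gcongr
          exact setOf_lt_enorm_curl_subset_ball hK hb ht
      _ = (t : ℝ≥0∞) ^ (9 / 5 : ℝ) *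
            (ENNReal.ofReal (r ^ Module.finrank ℝ (EuclideanSpace ℝ (Fin 3))) *
              volume (Metric.ball (0 : EuclideanSpace ℝ (Fin 3)) 1)) := by
          rw [Measure.addHaar_ball_of_pos volume (0 : EuclideanSpace ℝ (Fin 3)) hr]
      _ = ENNReal.ofReal (K ^ (9 / 5 : ℝ)) * volume (Metric.ball (0 : EuclideanSpace ℝ (Fin 3)) 1) := by
          rw [← mul_assoc, finrank_euclideanSpace_fin, hr3, ← ENNReal.ofReal_coe_nnreal,
            ENNReal.ofReal_rpow_of_pos htR,
            ← ENNReal.ofReal_mul (Real.rpow_nonneg (NNReal.coe_nonneg t) _),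
            ← Real.mul_rpow (NNReal.coe_nonneg t) hKt.le, mul_div_cancel₀ K htR.ne']

end Literature.Analysis.FluidPDE
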